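import Summits.ValiantsHypothesis.ValiantsHypothesis.Theorems.RigidityForcesSymmetryGrenetFirstOrderRankRigidDesignWord

/-!
# Route RigidityForcesSymmetry — `GrenetFirstOrderRankRigid` (item stmt-ValiantsHypothesis-21029),
line `grenet_gauge`: stub `stub_linearRigid`, step 5 (block I=) — the telescoping identities

For the crux line `Cruxes/GrenetFirstOrderRankRigid/Lines/grenet_gauge.lean` (blueprint
`Lines/grenet_gauge-stub_linearRigid-PROOF.md`, §5, block I=; interface `…-BLOCKS.md`, deliverables
(D-PQ, type I=) and (D-y)).  Applying the window identity (`grenet_window_identity'`) to design words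
(`designWord_valid_iff`):

* `grenet_blockIeq_PQ` — (D-PQ, I=): a genuine tail entry and a genuine head entry of the SAME vertex
  pair `(U, T)` with `|U| = |T|` have opposite values (word `[R i] α β [Tᶜ - β]`, window `{s, s+1}`);
* (D-y) — the both-type non-arc entries — is the companion file `…BlockIeqY` (word `[S - α] α f β [T'ᶜ - β]`,
  window `{s, s+1, s+2}`).

No new definitions.  VP ≠ VNP is not moved by this file.
-/

noncomputable section

open MvPolynomial Matrix Finset

namespace Summit.ValiantsHypothesis.Theorems.RigidityForcesSymmetry.GrenetGauge

open Literature.Computability.AlgebraicComplexity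

/-! ### Block I=: (D-PQ) — tail and head witnesses of an equal-size pair are opposite -/

section BlockIeq

variable {k : Type*} [CommRing k] [IsDomain k] {n N : ℕ} (e : Finset (Fin n) ≃ Fin (N + 1))

/-- **(D-PQ) for the equal-size pairs (block I= of the blueprint).**  Let `Σ_v x_v A'_v` be a
homogeneous direction Zariski-tangent at Grenet's pencil.  Let `(i, j, v)` be a GENUINE TAIL entry
(`v = (α, |R i|)`, `α ∉ R i`, `C j` not a `v`-head) and `(i', j', v')` a GENUINE HEAD entry
(`v'.1 = β ∈ C j'`, `|C j'| = v'.2 + 1`, `R i'` not a `v'`-tail) of the SAME vertex pair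
`(U, T) = (R i + α, C j) = (R i', C j' - β)` with `|U| = |T|`.  Then `A'_{v'} i' j' = -A'_v i j`:
the design word `[R i] α β [Tᶜ - β]` has exactly the two valid splits `s = |R i|`, `s + 1`, whose
entries are these two, and the window identity is their sum. [cite: Grenet2011, Thm. 1] -/
theorem grenet_blockIeq_PQ (hn : n ≠ 0) (hN : 2 ^ n = N + 1)
    (A' : Fin n × Fin n → Matrix (Fin N) (Fin N) k)
    (htr : ((Grenet.repr k n e).adjugate * ∑ v, (X v : MvPolynomial (Fin n × Fin n) k) • (A' v).map C).trace = 0)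
    (i j : Fin N) (v : Fin n × Fin n) (i' j' : Fin N) (v' : Fin n × Fin n)
    (ht1 : v.1 ∉ e.symm ((e univ).succAbove i)) (ht2 : (v.2 : ℕ) = (e.symm ((e univ).succAbove i)).card)
    (ht3 : ¬ (v.1 ∈ e.symm ((e ∅).succAbove j) ∧ (e.symm ((e ∅).succAbove j)).card = (v.2 : ℕ) + 1))
    (hh1 : v'.1 ∈ e.symm ((e ∅).succAbove j')) (hh2 : (e.symm ((e ∅).succAbove j')).card = (v'.2 : ℕ) + 1)
    (hh3 : ¬ (v'.1 ∉ e.symm ((e univ).succAbove i') ∧ (v'.2 : ℕ) = (e.symm ((e univ).succAbove i')).card))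
    (hU : insert v.1 (e.symm ((e univ).succAbove i)) = e.symm ((e univ).succAbove i'))
    (hT : e.symm ((e ∅).succAbove j) = (e.symm ((e ∅).succAbove j')).erase v'.1)
    (hsize : (e.symm ((e univ).succAbove i')).card = (e.symm ((e ∅).succAbove j)).card) :
    A' v' i' j' = -A' v i j := by
  classical
  -- notation
  set Xs := e.symm ((e univ).succAbove i) with hXs
  set U := e.symm ((e univ).succAbove i') with hUdef
  set T := e.symm ((e ∅).succAbove j) with hTdef
  set α := v.1 with hα
  set β := v'.1 with hβ
  set s : ℕ := (v.2 : ℕ) with hs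
  have hXcard : Xs.card = s := ht2.symm
  have hUcard : U.card = s + 1 := by rw [← hU, Finset.card_insert_of_notMem ht1, hXcard]
  have hTcard : T.card = s + 1 := by rw [← hsize, hUcard]
  have hCj' : e.symm ((e ∅).succAbove j') = insert β T := by rw [hT, Finset.insert_erase hh1]
  have hβT : β ∉ T := by rw [hT]; exact Finset.notMem_erase β _
  have hv'2 : (v'.2 : ℕ) = s + 1 := by
    have := hh2; rw [hCj', Finset.card_insert_of_notMem hβT, hTcard] at this; omega
  have hβU : β ∈ U := by
    by_contra h
    exact hh3 ⟨h, by rw [hv'2, hUcard]⟩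
  have hαT : α ∉ T := fun h => ht3 ⟨h, by rw [hTcard]⟩
  have hαU : α ∈ U := by rw [← hU]; exact Finset.mem_insert_self _ _
  have hsn : s + 2 ≤ n := by
    have h1 : (insert β T).card ≤ n := (Finset.card_le_univ _).trans_eq (Fintype.card_fin n)
    rw [Finset.card_insert_of_notMem hβT, hTcard] at h1; omega
  set Y := Tᶜ.erase β with hYdef
  have hβTc : β ∈ Tᶜ := Finset.mem_compl.mpr hβT
  have hYcard : Y.card = n - s - 2 := by
    rw [hYdef, Finset.card_erase_of_mem hβTc, Finset.card_compl, hTcard, Fintype.card_fin]; omega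
  -- the design word `[Xs] α β [Y]`
  set mid : Fin 2 → Fin n := ![α, β] with hmid
  set r : Fin n → Fin n := fun c =>
    if h : (c : ℕ) < s then ((Xs.orderIsoOfFin hXcard ⟨c, h⟩ : Xs) : Fin n)
    else if h' : (c : ℕ) - s < 2 then mid ⟨(c : ℕ) - s, h'⟩
    else ((Y.orderIsoOfFin hYcard ⟨(c : ℕ) - s - 2, by have := c.isLt; omega⟩ : Y) : Fin n) with hr_def
  have hr : ∀ c : Fin n, r c =
      if h : (c : ℕ) < s then ((Xs.orderIsoOfFin hXcard ⟨c, h⟩ : Xs) : Fin n)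
      else if h' : (c : ℕ) - s < 2 then mid ⟨(c : ℕ) - s, h'⟩
      else ((Y.orderIsoOfFin hYcard ⟨(c : ℕ) - s - 2, by have := c.isLt; omega⟩ : Y) : Fin n) := fun c => rfl
  have hmid0 : mid 0 = α := rfl
  have hmid1 : mid 1 = β := rfl
  have hrs : r ⟨s, by omega⟩ = α := by
    have h0 := designWord_apply_add Xs Y hXcard hYcard hsn mid r hr 0
    rw [hmid0] at h0
    exact h0
  have hrs1 : r ⟨s + 1, by omega⟩ = β := by
    have h1 := designWord_apply_add Xs Y hXcard hYcard hsn mid r hr 1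
    rw [hmid1] at h1
    exact h1
  -- images of the middle block
  have hmid_lt0 : (univ.filter fun i : Fin 2 => (i : ℕ) < 0).image mid = ∅ := by
    rw [Finset.image_eq_empty]; exact Finset.filter_false_of_mem fun i _ => Nat.not_lt_zero _
  have hf1 : (univ.filter fun i : Fin 2 => (i : ℕ) < 1) = {0} := by ext i; fin_cases i <;> simp
  have hmid_lt1 : (univ.filter fun i : Fin 2 => (i : ℕ) < 1).image mid = {α} := by
    rw [hf1, Finset.image_singleton, hmid0]
  have hf2 : (univ.filter fun i : Fin 2 => 0 < (i : ℕ)) = {1} := by ext i; fin_cases i <;> simp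
  have hmid_gt0 : (univ.filter fun i : Fin 2 => 0 < (i : ℕ)).image mid = {β} := by
    rw [hf2, Finset.image_singleton, hmid1]
  have hmid_gt1 : (univ.filter fun i : Fin 2 => 1 < (i : ℕ)).image mid = ∅ := by
    rw [Finset.image_eq_empty]; exact Finset.filter_false_of_mem fun i _ => by have := i.isLt; omega
  have hpre0 : (univ.filter fun c : Fin n => (c : ℕ) < s).image r = Xs := by
    have := designWord_pre Xs Y hXcard hYcard hsn mid r hr 0 (by omega)
    rw [Nat.add_zero, hmid_lt0, Finset.union_empty] at this; exact this
  have hpre1 : (univ.filter fun c : Fin n => (c : ℕ) < s + 1).image r = U := by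
    rw [designWord_pre Xs Y hXcard hYcard hsn mid r hr 1 (by omega), hmid_lt1, Finset.union_comm,
      ← Finset.insert_eq, hU]
  have hsuf0 : (univ.filter fun c : Fin n => s < (c : ℕ)).image r = Tᶜ := by
    have := designWord_suf Xs Y hXcard hYcard hsn mid r hr 0 (by omega)
    rw [Nat.add_zero, hmid_gt0] at this
    rw [this, hYdef, Finset.union_comm, ← Finset.insert_eq, Finset.insert_erase hβTc]
  have hsuf1 : (univ.filter fun c : Fin n => s + 1 < (c : ℕ)).image r = Y := by
    rw [designWord_suf Xs Y hXcard hYcard hsn mid r hr 1 (by omega), hmid_gt1, Finset.union_empty]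
  have hYc : Yᶜ = insert β T := by
    rw [hYdef]; ext x
    simp only [Finset.mem_compl, Finset.mem_erase, Finset.mem_insert, not_and, not_not]
    tauto
  -- validity: exactly the splits `s`, `s + 1`
  have hvalid : ∀ c : Fin n, (((univ.filter fun c' : Fin n => (c' : ℕ) < c).image r).card = c ∧
      ((univ.filter fun c' : Fin n => (c : ℕ) < c').image r).card = n - 1 - c) ↔ (s ≤ (c : ℕ) ∧ (c : ℕ) < s + 2) := by
    refine designWord_valid_iff Xs Y hXcard hYcard hsn mid r hr (by omega) ?_ ?_ ?_ ?_ ?_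
    · intro i hi
      have : i = 0 := Fin.ext (by omega)
      subst this; rw [hmid0]; exact ht1
    · intro i hi
      have : i = 1 := Fin.ext (by have := i.isLt; omega)
      subst this; rw [hmid1, hYdef]; exact Finset.notMem_erase β _
    · intro i i' hii' _
      have := i'.isLt; constructor <;> omega
    · by_cases hab : α = β
      · exact ⟨⟨s + 1, by omega⟩, by simp, by rw [hrs, hrs1, hab]⟩
      · have hαY : α ∈ Y := by
          rw [hYdef, Finset.mem_erase]; exact ⟨hab, Finset.mem_compl.mpr hαT⟩
        obtain ⟨p, hp, hpr⟩ := designWord_mem_Y Xs Y hXcard hYcard hsn mid r hr hαY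
        exact ⟨p, by omega, by rw [hpr, hrs]⟩
    · by_cases hab : α = β
      · exact ⟨⟨s, by omega⟩, by simp only; omega, by
          have h1 : (⟨s + 2 - 1, by omega⟩ : Fin n) = ⟨s + 1, by omega⟩ := Fin.ext (by simp)
          rw [h1, hrs, hrs1, hab]⟩
      · have hβX : β ∈ Xs := by
          have : β ∈ insert α Xs := by rw [hU]; exact hβU
          exact (Finset.mem_insert.mp this).resolve_left (Ne.symm hab)
        obtain ⟨p, hp, hpr⟩ := designWord_mem_X Xs Y hXcard hYcard hsn mid r hr hβX
        refine ⟨p, by omega, ?_⟩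
        have h1 : (⟨s + 2 - 1, by omega⟩ : Fin n) = ⟨s + 1, by omega⟩ := Fin.ext (by simp)
        rw [h1, hpr, hrs1]
  -- the window identity with the known indices
  have hwin := grenet_window_identity' e hn hN A' htr r
    (fun c => if (c : ℕ) = s then i else i') (fun c => if (c : ℕ) = s then j else j')
    (fun c h1 h2 => by
      obtain ⟨hc1, hc2⟩ := (hvalid c).mp ⟨h1, h2⟩
      by_cases hc : (c : ℕ) = s
      · rw [if_pos hc]
        have hf : (univ.filter fun c' : Fin n => (c' : ℕ) < c) = univ.filter fun c' : Fin n => (c' : ℕ) < s :=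
          Finset.filter_congr fun c' _ => by rw [hc]
        rw [hf, hpre0]
      · rw [if_neg hc]
        have hc' : (c : ℕ) = s + 1 := by omega
        have hf : (univ.filter fun c' : Fin n => (c' : ℕ) < c) = univ.filter fun c' : Fin n => (c' : ℕ) < s + 1 :=
          Finset.filter_congr fun c' _ => by rw [hc']
        rw [hf, hpre1])
    (fun c h1 h2 => by
      obtain ⟨hc1, hc2⟩ := (hvalid c).mp ⟨h1, h2⟩
      by_cases hc : (c : ℕ) = s
      · rw [if_pos hc]
        have hf : (univ.filter fun c' : Fin n => (c : ℕ) < c') = univ.filter fun c' : Fin n => s < (c' : ℕ) :=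
          Finset.filter_congr fun c' _ => by rw [hc]
        rw [hf, hsuf0, compl_compl]
      · rw [if_neg hc]
        have hc' : (c : ℕ) = s + 1 := by omega
        have hf : (univ.filter fun c' : Fin n => (c : ℕ) < c') = univ.filter fun c' : Fin n => s + 1 < (c' : ℕ) :=
          Finset.filter_congr fun c' _ => by rw [hc']
        rw [hf, hsuf1, hYc, hCj'])
  rw [Finset.filter_congr fun c _ => hvalid c] at hwin
  have hpair : (univ.filter fun c : Fin n => s ≤ (c : ℕ) ∧ (c : ℕ) < s + 2)
      = {(⟨s, by omega⟩ : Fin n), ⟨s + 1, by omega⟩} := by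
    ext c
    simp only [Finset.mem_filter, Finset.mem_univ, true_and, Finset.mem_insert, Finset.mem_singleton,
      Fin.ext_iff]
    omega
  rw [hpair, Finset.sum_pair (fun h => by rw [Fin.ext_iff] at h; simp only at h; omega)] at hwin
  simp only [Nat.succ_ne_self, if_true, if_false, hrs, hrs1] at hwin
  have hv : (α, (⟨s, by omega⟩ : Fin n)) = v := Prod.ext rfl (Fin.ext rfl)
  have hv' : (β, (⟨s + 1, by omega⟩ : Fin n)) = v' := Prod.ext rfl (Fin.ext hv'2.symm)
  rw [hv, hv'] at hwin
  linear_combination hwin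


end BlockIeq

end Summit.ValiantsHypothesis.Theorems.RigidityForcesSymmetry.GrenetGauge
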